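import Summits.BirchSwinnertonDyer.BirchSwinnertonDyer.Theorems.ByReductionTypeAtTwoRankOneAtTwoOffBigImageOddLocalEngineEndToEnd
import Summits.BirchSwinnertonDyer.BirchSwinnertonDyer.Theorems.ByReductionTypeAtTwoRankOneAtTwoOffBigImageOddLocalEnginePrescribedPrime
import Summits.BirchSwinnertonDyer.BirchSwinnertonDyer.Theorems.GenusKolyvaginAtTwoEquivariantChebotarevAtTwoSignedStepB
import HarnessLib

/-!
# Route `GenusKolyvaginAtTwo`, U⁺_T `ShaCardDvdPowAtTwoPosT` (stmt-BirchSwinnertonDyer-23378, Δ > 0) — the ONE missing lemma of B2Q⁺: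
# McCallum's Čebotarev with EXACT local orders at a REGULAR Kolyvagin prime, for SIGNED (τ-EIGEN) families `σ_* c_i = ± c_i` — PART A (§1–§2:
# the minus side of the regular involution, signed Step B with constants, the signed Galois-element producer); PART B (§3–§5) = `…PosTRegularSignedChebotarev`

Seat `bsd-line-gk2-p4` g23 (WIDTH-5 attach, cell `bsd-f1-sign2`), `--supports stmt-BirchSwinnertonDyer-23378 --as helper`.
THEOREMS ONLY (no definition, no named fact, no `sorry`).  BSD is NOT proved by any of this; U⁺_T / Q4_T are NOT claimed; nothing is closed.

WHY.  gk2-p5 g31's B2Q±-FRAME (LINE 19's sharp exponent over `ℚ` re-assembled sign-free: STATUS 2026-08-30T00:26Z/00:35Z) consumes, besides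
tree theorems, exactly ONE missing input: a Kolyvagin prime `ℓ` whose Frobenius acts on `E[2^{n+1}]` as a REGULAR involution `h` (cyclic frames
`(1 ± h)E[2^{n+1}] ≅ ℤ/2^{n+1}`, no lost bit on `Δ > 0`, unlike `c₀`-primes) at which TWO EIGENCLASSES of OPPOSITE τ-signs — the `ℚ`-Selmer class `s`
(`σ_* s = s`) and the Heegner class `y = c_M(1)` (`σ_* y = −y`) — have prescribed EXACT local orders.  The sibling crux 23716's landed engine
(`OffBigImageOddLocalAtTwo.Engine.exists_regular_kolyvaginPrime_of_supply`, fkl lead g0) does this for UNSIGNED `σ`-stable families `σ_* c_i = c_{π i}`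
(an anti-invariant class fits that shape only as the dependent pair `{y, −y}`); GK2's `…EquivariantChebotarevAtTwoSigned` does SIGNED families but at
`c₀`-primes (`Δ < 0`).  This file merges the two for `π = id` (McCallum's printed eigenclass case):
* §1 algebra — the MINUS side of the regular involution `reg b = [[1,1],[0,−1]]`: `two_pow_smul_basis_one_sub_reg_ne_zero` (`b₁ − reg b₁` has full order;
  `ker(reg + 1) = im(1 − reg)` is the fkl lead's `Engine.exists_eq_sub_reg_of_reg_eq_neg`, imported); and Step B targets with SIGNS AND CONSTANTS
  `exists_orders_regular_signed` (`κ_i + s_i A x_i + x_i` of exact order `2^{N_i}`, given `A κ_i = s_i κ_i`, `ker(A ∓ 1) = im(A ± 1)`, `P ± AP` of full order);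
* §2 the signed Galois-element producer at a regular element `exists_h1Eval_conj_mul_order_regular_signed` (the engine's §H with
  `h1Eval_conjGalCMH_of_signStable` in place of `…_of_tauStable`: value `[c_i, (ρ₀ n m)^τ(ρ₀ n m)] = κ_i + s_i A[c_i, n] + [c_i, n]`);
* §3 its `ℚ`-side packaging `exists_galoisElement_regular_rat_signed`; §4 the regular element with BOTH-sign losslessness
  `exists_regular_galoisElement_of_supply_signed`; §5 END-TO-END `exists_regular_kolyvaginPrime_of_supply_signed` / `…_of_heegner_signed`
  (Steps C–H = the engine's `exists_kolyvaginPrime_gt_two_of_galoisElement_regular`, unchanged): output shape = the engine's / GK2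
  `GenusRegularSupply.regularKolyvaginSupplyAtTwo_proof`, for eigen families.
Consumer: g31's B2Q±-FRAME with `r = 2`, `cs = (ι_* res s, ι_* y)`, `sgn = (1, −1)` (independent case; the dependent case — common socle — reduces to
`r = 1` exactly as in gk2-p2's `…RTFullOrderPairChebotarev`).

References: [McCallumLMS1991] §3 (2), Prop. 3.1, Cor. 3.2; [GrossLMS1991] §3 (3.1)–(3.3), §9 Prop. 9.3; [Kolyvagin1989Izv] §3.
-/

set_option autoImplicit false
-- the Theorems namespace of this sub repeats the summit name by design (D-0017 nested layout)
set_option linter.dupNamespace false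

noncomputable section

namespace Summit.BirchSwinnertonDyer.BirchSwinnertonDyer.Theorems.GenusExact.RegularSigned

open scoped Classical
open WeierstrassCurve Field Finset
open Literature.NumberTheory.EllipticCurves
open Summit.BirchSwinnertonDyer.BirchSwinnertonDyer.Theorems.GenusExact
open Summit.BirchSwinnertonDyer.BirchSwinnertonDyer.Theorems.OffBigImageOddLocalAtTwo.Engine

/-! ## §1a The minus side of the regular involution `[[1,1],[0,−1]]` -/

section RegMinus

variable {q : ℕ} {T : Type*} [AddCommGroup T] [Module (ZMod q) T] (b : Module.Basis (Fin 2) (ZMod q) T)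

-- `ker(reg + 1) = im(1 − reg)` on every `c`-torsion (`exists_eq_sub_reg_of_reg_eq_neg`) is the fkl lead's §J′
-- (`…EnginePrescribedPrime`, imported); only the full-order witness of the minus side is added here.

/-- `b₁ − reg b₁ = 2•b₁ − b₀` has first coordinate `−1`. [folklore] -/
theorem repr_basis_one_sub_reg_zero : b.repr (b 1 - reg b (b 1)) 0 = -1 := by
  simp [reg_basis_one]

/-- **`b₁ − reg b₁` has FULL order** in `E[2^{n+1}]` (`q = 2^{n+1}`): `2^n • (b₁ − reg b₁) ≠ 0` (its first coordinate is `−2^n ≠ 0`).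
[folklore] -/
theorem two_pow_smul_basis_one_sub_reg_ne_zero {n : ℕ} {T : Type*} [AddCommGroup T] [Module (ZMod (2 ^ (n + 1))) T]
    (b : Module.Basis (Fin 2) (ZMod (2 ^ (n + 1))) T) :
    (2 : ℤ) ^ n • (b 1 - reg b (b 1)) ≠ 0 := by
  intro h
  have h0 := congrArg (fun Z ↦ b.repr Z 0) h
  rw [← Int.cast_smul_eq_zsmul (ZMod (2 ^ (n + 1)))] at h0
  simp only [map_smul, Finsupp.smul_apply, repr_basis_one_sub_reg_zero, smul_eq_mul, mul_neg, mul_one, map_zero,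
    Finsupp.coe_zero, Pi.zero_apply, neg_eq_zero] at h0
  exact two_pow_ne_zero_zmod n h0

end RegMinus

/-! ## §1b Step B targets for a SIGNED eigen family at a regular element (signs and constants) -/

section StepBSignedAlgebra

variable {T : Type*} [AddCommGroup T]

/-- **Step B targets, signed, with constants.**  `A` an additive involution of `T` (the action of the regular `h₀` on `E[2^M]`), `P` with
`2^M P = 0` and BOTH `P + AP`, `P − AP` of full order (`hP1p`, `hP1m`), BOTH kernel conditions `ker(A − 1) = im(A + 1)`, `ker(A + 1) = im(1 − A)`
on each `T[2^e]`, `e ≤ M` (`hkerp`, `hkerm`); signs `s_i = ±1`, exponents `N_i ≤ e_i ≤ M`, CONSTANTS `κ_i ∈ T[2^{e_i}]` with `A κ_i = s_i κ_i`.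
Then there is `x : ι → T`, `2^{e_i} x_i = 0`, with `κ_i + s_i A x_i + x_i` of order EXACTLY `2^{N_i}` for every `i`: write `κ_i = y_i + s_i A y_i`
(kernel condition of sign `s_i`) and take `x_i := 2^{M−N_i} P − y_i`, value `2^{M−N_i}(P + s_i AP)`.  (The engine's `exists_orders_regular` is the
unsigned `π`-stable version; GK2's `exists_orders_of_signStable` the constant-free one.) [cite: McCallumLMS1991, Prop. 3.1, Cor. 3.2 (proof)] -/
theorem exists_orders_regular_signed (A : T →+ T) {M : ℕ} {P : T}
    (hPM : (2 : ℤ) ^ M • P = 0)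
    (hP1p : M ≠ 0 → (2 : ℤ) ^ (M - 1) • (P + A P) ≠ 0)
    (hP1m : M ≠ 0 → (2 : ℤ) ^ (M - 1) • (P - A P) ≠ 0)
    (hkerp : ∀ (e : ℕ) (t : T), e ≤ M → (2 : ℤ) ^ e • t = 0 → A t = t →
      ∃ y : T, (2 : ℤ) ^ e • y = 0 ∧ t = y + A y)
    (hkerm : ∀ (e : ℕ) (t : T), e ≤ M → (2 : ℤ) ^ e • t = 0 → A t = -t →
      ∃ y : T, (2 : ℤ) ^ e • y = 0 ∧ t = y - A y)
    {ι : Type*} (sgn : ι → ℤ) (hsgn : ∀ i, sgn i = 1 ∨ sgn i = -1)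
    (e N : ι → ℕ) (hNe : ∀ i, N i ≤ e i) (heM : ∀ i, e i ≤ M)
    (κ : ι → T) (hκe : ∀ i, (2 : ℤ) ^ e i • κ i = 0) (hκA : ∀ i, A (κ i) = sgn i • κ i) :
    ∃ x : ι → T, (∀ i, (2 : ℤ) ^ e i • x i = 0) ∧
      ∀ i, (2 : ℤ) ^ N i • (κ i + sgn i • A (x i) + x i) = 0 ∧
        (N i ≠ 0 → (2 : ℤ) ^ (N i - 1) • (κ i + sgn i • A (x i) + x i) ≠ 0) := by
  have hAPM : (2 : ℤ) ^ M • A P = 0 := by rw [← map_zsmul, hPM, map_zero]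
  have hNM : ∀ i, N i ≤ M := fun i ↦ (hNe i).trans (heM i)
  -- `P + s • A P` has `2`-adic order `2^M` for both signs
  have hQM : ∀ i, (2 : ℤ) ^ M • (P + sgn i • A P) = 0 := fun i ↦ by
    rw [smul_add, smul_comm, hAPM, smul_zero, hPM, zero_add]
  have hQ1 : ∀ i, M ≠ 0 → (2 : ℤ) ^ (M - 1) • (P + sgn i • A P) ≠ 0 := fun i hM ↦ by
    rcases hsgn i with h | h
    · rw [h, one_smul]; exact hP1p hM
    · rw [h, neg_one_smul, ← sub_eq_add_neg]; exact hP1m hM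
  -- the correcting elements: `κ i = y i + s_i • A (y i)`, `2^{e i} y i = 0`
  have hy : ∀ i, ∃ y : T, (2 : ℤ) ^ e i • y = 0 ∧ κ i = y + sgn i • A y := fun i ↦ by
    rcases hsgn i with h | h
    · obtain ⟨y, hy, hκ⟩ := hkerp (e i) (κ i) (heM i) (hκe i) (by rw [hκA i, h, one_smul])
      exact ⟨y, hy, by rw [h, one_smul]; exact hκ⟩
    · obtain ⟨y, hy, hκ⟩ := hkerm (e i) (κ i) (heM i) (hκe i) (by rw [hκA i, h, neg_one_smul])
      exact ⟨y, hy, by rw [h, neg_one_smul, ← sub_eq_add_neg]; exact hκ⟩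
  choose y hy using hy
  have hPe : ∀ i, (2 : ℤ) ^ e i • ((2 : ℤ) ^ (M - N i) • P) = 0 := fun i ↦ by
    rw [smul_smul, ← pow_add, show e i + (M - N i) = M + (e i - N i) by
      have := hNe i; have := heM i; omega, pow_add, mul_comm, mul_smul, hPM, smul_zero]
  refine ⟨fun i ↦ (2 : ℤ) ^ (M - N i) • P - y i, fun i ↦ ?_, fun i ↦ ?_⟩
  · rw [smul_sub, hPe, (hy i).1, sub_zero]
  · have hval : κ i + sgn i • A ((2 : ℤ) ^ (M - N i) • P - y i) + ((2 : ℤ) ^ (M - N i) • P - y i) =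
        (2 : ℤ) ^ (M - N i) • (P + sgn i • A P) := by
      rw [(hy i).2, map_sub, map_zsmul, smul_sub, smul_add, smul_comm (sgn i) ((2 : ℤ) ^ (M - N i)) (A P)]
      abel
    rw [hval]
    exact zsmul_pow_sub_order (hNM i) (hQM i) fun hN0 ↦ hQ1 i (by have := hNM i; omega)

end StepBSignedAlgebra

/-! ## §2 The signed Galois-element producer at a regular element -/

section StepBSignedGalois

universe u v

variable {k : Type v} {K : Type u} [Field k] [Field K] [Algebra k K] (W : WeierstrassCurve k)
variable {σ : K ≃ₐ[k] K} {τ : AlgebraicClosure K ≃+* AlgebraicClosure K}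

/-- **McCallum's Galois element at `2` for a SIGNED eigen family at a REGULAR element.**  As the engine's
`exists_h1Eval_conj_mul_order_regular` (search `ρ = ρ₀ · n`, `n ∈ Γ_{K(E[n])}`, for a fixed `ρ₀` with `k₀ := ρ₀^τ ρ₀ ∈ Γ_{K(E[n])}`; involution
`A := ρ₀⁻¹ ∘ τ` on `E[n]`), but for EIGENCLASSES `σ_* x_i = s_i x_i` (`s_i = ±1`) instead of a `π`-stable family, with BOTH-sign losslessness
(`hP1p/hP1m`, `hkerp/hkerm`).  The values are `[x_i, (ρ m)^τ (ρ m)] = [x_i, k₀] + s_i A [x_i, n] + [x_i, n]` (`h1Eval_conjGalCMH_of_signStable`);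
§1b absorbs the constant.  Output: `n` with `ord [x_i, (ρ₀ n m)^τ (ρ₀ n m)] = 2^{N_i}` exactly for all `m ∈ 𝒩`, all `i`.
[cite: McCallumLMS1991, §3 (2), Prop. 3.1, Cor. 3.2] [cite: GrossLMS1991, §9 Prop. 9.3] -/
theorem exists_h1Eval_conj_mul_order_regular_signed [W.IsElliptic] (hτ : IsLiftOfAut σ τ)
    (hinv : ∀ x, τ (τ x) = x) {n : ℤ} (h2n : (2 : ℤ) ∣ n) {M : ℕ}
    (hS : ∀ H : AddSubgroup (geomTorsion (W.baseChange K) 2),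
      (∀ g : absoluteGaloisGroup K, ∀ t ∈ H, g • t ∈ H) → H = ⊥ ∨ H = ⊤)
    (hC : ∀ f : geomTorsion (W.baseChange K) 2 →+ geomTorsion (W.baseChange K) 2,
      (∀ (g : absoluteGaloisGroup K) (t : geomTorsion (W.baseChange K) 2), f (g • t) = g • f t) →
        ∃ c : ℤ, ∀ t, f t = c • t)
    (ρ₀ : absoluteGaloisGroup K)
    (hk₀ : hτ.conjGalCMH ρ₀ * ρ₀ ∈ torsionFixing (W.baseChange K) n)
    {P : geomTorsion (W.baseChange K) n} (hPM : (2 : ℤ) ^ M • P = 0)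
    (hP1p : M ≠ 0 → (2 : ℤ) ^ (M - 1) • (P + ρ₀⁻¹ • hτ.torsionMap W n P) ≠ 0)
    (hP1m : M ≠ 0 → (2 : ℤ) ^ (M - 1) • (P - ρ₀⁻¹ • hτ.torsionMap W n P) ≠ 0)
    (hkerp : ∀ (e : ℕ) (t : geomTorsion (W.baseChange K) n), e ≤ M → (2 : ℤ) ^ e • t = 0 →
      ρ₀⁻¹ • hτ.torsionMap W n t = t →
        ∃ y : geomTorsion (W.baseChange K) n, (2 : ℤ) ^ e • y = 0 ∧ t = y + ρ₀⁻¹ • hτ.torsionMap W n y)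
    (hkerm : ∀ (e : ℕ) (t : geomTorsion (W.baseChange K) n), e ≤ M → (2 : ℤ) ^ e • t = 0 →
      ρ₀⁻¹ • hτ.torsionMap W n t = -t →
        ∃ y : geomTorsion (W.baseChange K) n, (2 : ℤ) ^ e • y = 0 ∧ t = y - ρ₀⁻¹ • hτ.torsionMap W n y)
    {ι : Type*} [Fintype ι] {xs : ι → galH1Torsion (W.baseChange K) n} {sgn : ι → ℤ}
    (hsgn : ∀ i, sgn i = 1 ∨ sgn i = -1) (hxs : ∀ i, conjAct W σ n (xs i) = sgn i • xs i)
    (e : ι → ℕ) (he : ∀ i, ((2 : ℤ) ^ e i) • xs i = 0)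
    (hind : ∀ a : ι → ℤ, ∑ i, a i • xs i = 0 → ∀ i, ((2 : ℤ) ^ e i) ∣ a i)
    (hres : ∀ a : ι → ℤ, (∀ ρ ∈ torsionFixing (W.baseChange K) n,
      h1Eval (W.baseChange K) n (∑ i, a i • xs i) ρ = 0) → ∑ i, a i • xs i = 0)
    (Nv : ι → ℕ) (hNe : ∀ i, Nv i ≤ e i) (heM : ∀ i, e i ≤ M) :
    ∃ nn ∈ torsionFixing (W.baseChange K) n, ∀ m ∈ evalKer (W.baseChange K) n xs, ∀ i,
      ((2 : ℤ) ^ Nv i) • h1Eval (W.baseChange K) n (xs i)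
          (hτ.conjGalCMH (ρ₀ * nn * m) * (ρ₀ * nn * m)) = 0 ∧
      (Nv i ≠ 0 →
        ((2 : ℤ) ^ (Nv i - 1)) • h1Eval (W.baseChange K) n (xs i)
          (hτ.conjGalCMH (ρ₀ * nn * m) * (ρ₀ * nn * m)) ≠ 0) := by
  set TF := torsionFixing (W.baseChange K) n with hTF
  set k₀ := hτ.conjGalCMH ρ₀ * ρ₀ with hk₀def
  -- the involution `A = ρ₀⁻¹ ∘ τ` of `E[n]`
  have hτinv : ∀ s : geomTorsion (W.baseChange K) n,
      hτ.torsionMap W n (ρ₀⁻¹ • s) = (hτ.conjGalCMH ρ₀)⁻¹ • hτ.torsionMap W n s := fun s ↦ by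
    rw [← map_inv, ← hτ.torsionMap_smul W n, hτ.conjGalCMH_conjGalCMH hinv]
  set A : geomTorsion (W.baseChange K) n →+ geomTorsion (W.baseChange K) n :=
    { toFun := fun s ↦ ρ₀⁻¹ • hτ.torsionMap W n s
      map_zero' := by rw [map_zero, smul_zero]
      map_add' := fun s t ↦ by rw [map_add, smul_add] } with hAdef
  have hA : ∀ s, A s = ρ₀⁻¹ • hτ.torsionMap W n s := fun _ ↦ rfl
  have hA2 : ∀ t, A (A t) = t := fun t ↦ by
    rw [hA, hA, hτinv, hτ.torsionMap_torsionMap W hinv, smul_smul, ← mul_inv_rev,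
      smul_eq_of_mem_torsionFixing _ n (inv_mem hk₀)]
  -- the constants `κ i = [x_i, k₀]`
  set κ : ι → geomTorsion (W.baseChange K) n := fun i ↦ h1Eval (W.baseChange K) n (xs i) k₀ with hκdef
  have hκe : ∀ i, (2 : ℤ) ^ e i • κ i = 0 := fun i ↦ by
    rw [hκdef]
    simp only
    rw [← h1Eval_zsmul _ n _ _ hk₀, he i, h1Eval_zero _ n hk₀]
  have hconjk₀ : hτ.conjGalCMH k₀ = ρ₀ * k₀ * ρ₀⁻¹ := by
    rw [hk₀def, map_mul, hτ.conjGalCMH_conjGalCMH hinv, mul_assoc, mul_inv_cancel_right]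
  -- `A (s_i • κ_i) = κ_i`, hence `A κ_i = s_i • κ_i`
  have hκA' : ∀ i, A (sgn i • κ i) = κ i := fun i ↦ by
    rw [hA, hκdef]
    simp only
    rw [← h1Eval_zsmul _ n _ _ hk₀, ← hxs i, hτ.h1Eval_conjAct W n (xs i) hk₀, hconjk₀, h1Eval_conj _ n _ ρ₀ hk₀,
      hτ.torsionMap_torsionMap W hinv, inv_smul_smul]
  have hκA : ∀ i, A (κ i) = sgn i • κ i := fun i ↦ by
    have h := congrArg (fun z ↦ sgn i • z) (hκA' i)
    simp only [map_zsmul, smul_smul] at h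
    rcases hsgn i with hs | hs
    · rw [hs, one_smul]; rw [hs, mul_one, one_smul] at h; exact h
    · rw [hs, mul_neg, mul_one, neg_neg, one_smul] at h; rw [hs]; exact h
  -- the targets (§1b) and their realisation as `([x_i, nn])_i` (Gross 9.3 / McCallum (2))
  obtain ⟨x, hxe, hx⟩ := exists_orders_regular_signed A hPM hP1p hP1m hkerp hkerm sgn hsgn e Nv hNe heM κ hκe hκA
  obtain ⟨nn, hnn, hnne⟩ := exists_h1Eval_eq_of_indep_of_res (W.baseChange K) Nat.prime_two h2n hS hC
    xs e he hind hres x hxe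
  refine ⟨nn, hnn, fun m hm i ↦ ?_⟩
  have hnm : nn * m ∈ TF := mul_mem hnn hm.1
  have hconj_nm : hτ.conjGalCMH (nn * m) ∈ TF := hτ.conjGalCMH_mem_torsionFixing W hinv _ hnm
  have hY : ρ₀⁻¹ * hτ.conjGalCMH (nn * m) * ρ₀⁻¹⁻¹ ∈ TF := (torsionFixing_normal _ n).conj_mem _ hconj_nm ρ₀⁻¹
  have hdecomp : hτ.conjGalCMH (ρ₀ * nn * m) * (ρ₀ * nn * m) =
      k₀ * ((ρ₀⁻¹ * hτ.conjGalCMH (nn * m) * ρ₀⁻¹⁻¹) * (nn * m)) := by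
    rw [hk₀def, mul_assoc ρ₀ nn m, map_mul]
    group
  have hxnm : h1Eval (W.baseChange K) n (xs i) (nn * m) = x i := by
    rw [h1Eval_mul _ _ _ hnn, hnne i, hm.2 i, add_zero]
  -- the signed evaluation identity `[x_i, (nn m)^τ] = s_i τ [x_i, nn m]` (π = id)
  have hsig : h1Eval (W.baseChange K) n (xs i) (hτ.conjGalCMH (nn * m)) = sgn i • hτ.torsionMap W n (x i) := by
    have h := h1Eval_conjGalCMH_of_signStable W hτ hinv n (π := id) hxs hnm i
    rw [← hxnm]
    exact h
  have hval : h1Eval (W.baseChange K) n (xs i) (hτ.conjGalCMH (ρ₀ * nn * m) * (ρ₀ * nn * m)) =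
      κ i + sgn i • A (x i) + x i := by
    rw [hdecomp, h1Eval_mul _ _ _ hk₀, h1Eval_mul _ _ _ hY, h1Eval_conj _ n _ ρ₀⁻¹ hconj_nm, hsig, hxnm,
      smul_comm ρ₀⁻¹ (sgn i) (hτ.torsionMap W n (x i)), hA, add_assoc]
  rw [hval]
  exact hx i

end StepBSignedGalois


end Summit.BirchSwinnertonDyer.BirchSwinnertonDyer.Theorems.GenusExact.RegularSigned

end
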